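import Summits.BirchSwinnertonDyer.Rank1Residual.Additive.RamifiedSevenGenusKatoExpDatum
import HarnessLib

set_option autoImplicit false

/-!
# `𝒞₇` genus road (crux `EllipticUnitValueSevenOfGZK`, K7r), REPAIR ROW (C6-R) step 3: block (R) PORTED over the re-typed
# datum — `RationalComparisonShape Φ` (with explicit constants: `TwoSided…`/`PeriodScaled…`) PROVED from a `KatoExpDatum hγ Φ`,
# the structural binders (tf)/(rk)/(ht′), characters, continuations and generic non-vanishing (r5′), by Kato's argument
# (values agree at almost all characters + rank-one separation); and the pen's corollary in the «K2cPinned» currency over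
# `KatoExpCompatShape` — THEOREMS ONLY; nothing asserted, no named fact

Cell bsd-cm, seat bsd-cm-prr-ty1 g34 (literature-prover), REPAIR ROW (C6-R) (pen bsd-cm-plan g37 D1009 (3) / D1011), port of
`RamifiedSevenRationalComparisonOfInputs.lean` (seat g30, p782019) whose four theorems bind `D : DualExpValueDatum hγ Φ` — an
EMPTY type (ERRATUM in `RamifiedSevenGenusKatoExpDatum`'s module docstring; pen D1008) — and are therefore vacuous as typed.
The proofs are VERBATIM except in STEP 1 of ★, where the dead Skolemised Artin exponent `a_𝔟 : ℕ` with `P := (1+X)^{a_𝔟}` is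
replaced by `P := σ_𝔟 = D.sigma 𝔟 = (1+X)^{κ(𝔟)}` (LEVEL-FREE, as the cyclotomic-divisibility step over infinitely many levels
requires) and, at each level `n+1`, a natural lift `a ≡ κ(𝔟) (mod 7^{n+1})` (`D.exists_nat_toZModPow_artExp`) with
`hw := D.inv_heckeIdealValue_eq_pow` (`χ(𝔟)⁻¹ = u^a`) and `hPval := D.val_sigma_smul_eq_pow` (`val χ (σ_𝔟 • m) = u^a·val χ m`,
through the Literature lemma `val_binomialSeries_smul`); and (e1)(e1′)(e2)/`val_intCast_smul` are invoked at the finite-level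
witness `⟨n+1, hχU⟩`.  `ev_normForm_eq_zero` (block (A)) takes `P`, `w` opaque, so STEPS 1′–3 are untouched.  Imports the datum
file (which brings (E) KatoExpFrame, (A) RationalComparisonAlgebra, (P3) and the Literature kernels).  HONEST LABEL: conditional
theorems; every hypothesis displayed; nothing about Kato's Conj. 12.10, `X12.CMRamifiedSeven` or BSD is asserted;
stmt-BirchSwinnertonDyer-19945 is OPEN; no summit statement is proved by this seat; BSD is claimed for no curve.

## The argument and the binders
As in `RamifiedSevenRationalComparisonOfInputs` («The argument», «The binders»), with (R3) now `KatoExpCompatShape hγ Φ` and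
(art) the level-wise eigen-law of `σ_𝔟` (a THEOREM of the datum file, `KatoExpDatum.val_sigma_smul`).

## For the pen
`k2cPinned_of_katoExpCompat_of_divisibility` = the old `k2cPinned_of_dualExpCompat_of_divisibility` with
`DualExpCompatShape ↦ KatoExpCompatShape` in the existential (same `★ → GZK → ∀ W … ∀ d` prefix); it is what the zp v17 touch
(T-art) of `stub_integralComparisonInputsSeven` consumes.

References: K. Kato, Astérisque 295 (2004) (15.16.1)/Prop. 15.17 (p. 265), (15.12.2) (p. 263), 15.14 (p. 264), Prop. 15.9
(p. 258), Thm. 12.4 (2)/12.5 (1)(2) (p. 221), §13.9 (p. 230), 13.5 (p. 227) [Kato2004Asterisque]; L. C. Washington (1997)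
§7.1, Thm. 7.3, §13.2 [Washington1997]; D. Rohrlich, Invent. Math. 75 (1984) [RohrlichInventiones1984]; block (R) p782019,
(A), (P1), (P3), (E) p781874, (C6-R) steps 1–2; `K2cCollapse-g57.md` §2.
-/

noncomputable section

open scoped NumberField TensorProduct
open Field IsDedekindDomain NumberField Polynomial
open Literature.NumberTheory.GaloisRepresentations
open Literature.NumberTheory.EllipticCurves
open Literature.NumberTheory.EllipticCurves.Rank1Residual
open Literature.NumberTheory.EllipticCurves.IwasawaAlgebra
open Literature.NumberTheory.EllipticCurves.Kato2004
open Literature.NumberTheory.ComplexMultiplication.EllipticUnits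
open Summit.BirchSwinnertonDyer.Rank1Residual

namespace Summit.BirchSwinnertonDyer.Rank1Residual.Additive.GenusSeven

/-! ## §1 ★ The comparison at a pinned frame FROM ITS INPUTS over `KatoExpDatum` — exact constants -/

section Frame

variable {W : WeierstrassCurve ℚ} [W.IsElliptic] [W.IsGloballyMinimal] [Fact (Nat.Prime 7)]
  [ContinuousSMul ℤ_[7] (W.tateModule 7)] {K : ZpExtension ℚ 7} {hK : K.IsCyclotomic}
  {γ : Field.absoluteGaloisGroup ℚ} {I : IwasawaH1Data W 7 K γ}
  {F : GenusFrame} {θu : ∀ n : ℕ, globalUnitsOf (F.layer n)} {d : GenusDatum F θu}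

set_option maxHeartbeats 800000 in
/-- ★ **THE TWO-SIDED COMPARISON WITH EXPLICIT CONSTANTS, FROM ITS INPUTS** (LEMMA S output; module docstring «The
argument»/«The binders»): for a RE-TYPED dual-exponential value datum `D : KatoExpDatum hγ Φ` (R3), `t·t′ = π^{m₀}`
(ht′), (tf), (rk), characters of every primitive level, continuations and generic non-vanishing (r5′):
`(π^{m₀}·2N(α)) • EU_𝔟 = ((D.cZ·t′)·D.xTilde 𝔟) • 𝐳_{γ′}` for EVERY admissible `𝔟` — `TwoSidedComparisonShape Φ D.xTilde s c`
with `s = π^{m₀}·2(α₀² + 7α₁²)` and `c = D.cZ·t′` NAMED.  Value agreement + the PROVED rank-one separation ((S-Λ) p779481,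
(S-ev), (S-N)).  CONDITIONAL; nothing asserted; 19945 OPEN.
[cite: Kato2004Asterisque, (15.16.1) (p. 265) "By (15.12.2) and Thm. 12.4 (2)", Prop. 15.9 (p. 258), Thm. 12.5 (1) (p. 221), §13.9 (p. 230), 13.5 (p. 227)] -/
theorem twoSidedComparisonShape_of_katoExpDatum (hγ : K.IsTopGenerator γ) (Φ : PinnedKatoGenusFrame W K hK I d)
    (D : KatoExpDatum hγ Φ) (t' : Φ.R) (m₀ : ℕ) (ht : Φ.t * t' = Φ.π ^ m₀)
    (htf : ∀ (f : IwasawaAlgebra 7) (x : Φ.IK.H), f ≠ 0 → f • x = 0 → x = 0)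
    (hrk : ∀ x y : Φ.IK.H, ∃ s r₀ r₁ : IwasawaAlgebra 7,
      (s ≠ 0 ∨ r₀ ≠ 0 ∨ r₁ ≠ 0) ∧ s • x = r₀ • y + r₁ • Φ.piK y)
    (hχ : ∀ n : ℕ, ∃ χ : absoluteGaloisGroup Φ.Kcm →ₜ* ℂˣ,
      (∀ σ ∈ (K.restrictOfFinrankEqTwo (by decide) Φ.Kcm Φ.finrank_Kcm).layerSubgroup (n + 1), χ σ = 1) ∧
        IsPrimitiveRoot (((χ Φ.γK : ℂˣ)) : ℂ) (7 ^ (n + 1)))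
    (hL : ∀ χ : absoluteGaloisGroup Φ.Kcm →ₜ* ℂˣ, ∃ Lf : ℂ → ℂ, CM.IsDepletedHeckeL Φ.ψ χ (7 * (7 * F.d)) Lf)
    (hRoh : ∃ n₁ : ℕ, ∀ n : ℕ, n₁ ≤ n → ∀ χ : absoluteGaloisGroup Φ.Kcm →ₜ* ℂˣ,
      (∀ σ ∈ (K.restrictOfFinrankEqTwo (by decide) Φ.Kcm Φ.finrank_Kcm).layerSubgroup (n + 1), χ σ = 1) →
      IsPrimitiveRoot (((χ Φ.γK : ℂˣ)) : ℂ) (7 ^ (n + 1)) →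
      ∀ Lf : ℂ → ℂ, CM.IsDepletedHeckeL Φ.ψ χ (7 * (7 * F.d)) Lf → Lf 1 ≠ 0) :
    TwoSidedComparisonShape Φ D.xTilde
      (Φ.π ^ m₀ * algebraMap (IwasawaAlgebra 7) Φ.R (((2 * (D.α₀ ^ 2 + 7 * D.α₁ ^ 2) : ℤ) : IwasawaAlgebra 7)))
      (D.cZ * t') := by
  classical
  obtain ⟨n₁, hn₁⟩ := hRoh
  intro 𝔟 h𝔟
  obtain ⟨s, r₀, r₁, hne, hdep⟩ := hrk (Φ.euK 𝔟) D.zStar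
  -- opaque names for the explicit data
  obtain ⟨b₀, hb₀def⟩ : ∃ b : ℤ, b = D.bCoef₀ 𝔟 := ⟨_, rfl⟩
  obtain ⟨b₁, hb₁def⟩ : ∃ b : ℤ, b = D.bCoef₁ 𝔟 := ⟨_, rfl⟩
  have hb : 2 * CM.heckeCharIdealValue Φ.ψ 𝔟 =
      (b₀ : ℂ) + (b₁ : ℂ) * Φ.ιC (algebraMap Φ.Kcm (AlgebraicClosure Φ.Kcm) Φ.sqrtNegSeven) := by
    rw [hb₀def, hb₁def]; exact D.psi_eq 𝔟 h𝔟
  obtain ⟨q, hqdef⟩ : ∃ q : ℂ, q = Φ.ιC (algebraMap Φ.Kcm (AlgebraicClosure Φ.Kcm) Φ.sqrtNegSeven) := ⟨_, rfl⟩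
  have hq : q ^ 2 = -7 := by rw [hqdef]; exact Φ.ιC_sqrtNegSeven_sq
  obtain ⟨P, hPdef⟩ : ∃ P : IwasawaAlgebra 7, P = D.sigma 𝔟 := ⟨_, rfl⟩
  obtain ⟨c₁, hc₁⟩ : ∃ c : ℤ, c = 7 ^ D.e := ⟨_, rfl⟩
  obtain ⟨N, hNdef⟩ : ∃ N : ℕ, N = Ideal.absNorm 𝔟 := ⟨_, rfl⟩
  obtain ⟨g₀, hg₀⟩ : ∃ g : IwasawaAlgebra 7, g = (c₁ : IwasawaAlgebra 7) * s *
      (((2 * N : ℕ) : ℤ) - (b₀ : IwasawaAlgebra 7) * P) -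
    2 * ((D.α₀ : IwasawaAlgebra 7) * r₀ - ((7 * D.α₁ : ℤ) : IwasawaAlgebra 7) * r₁) := ⟨_, rfl⟩
  obtain ⟨g₁, hg₁⟩ : ∃ g : IwasawaAlgebra 7, g = -((c₁ : IwasawaAlgebra 7) * (b₁ : IwasawaAlgebra 7) * s * P) -
    2 * ((D.α₁ : IwasawaAlgebra 7) * r₀ + (D.α₀ : IwasawaAlgebra 7) * r₁) := ⟨_, rfl⟩
  -- STEP 1 (values ⇒ divisibility): `Φ_{7^{n+1}}(1+X) ∣ g₀² + 7g₁²` for every `n ≥ max n₀ n₁`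
  have hdiv : ∀ n : ℕ, max D.n₀ n₁ ≤ n →
      ((((cyclotomic (7 ^ (n + 1)) ℤ).comp (X + 1)).map (Int.castRingHom ℤ_[7]) : ℤ_[7][X]) : IwasawaAlgebra 7) ∣
        (g₀ * g₀ + ((7 : ℤ) : IwasawaAlgebra 7) * (g₁ * g₁)) := by
    intro n hn
    obtain ⟨χ, hχU, hprim⟩ := hχ n
    obtain ⟨Lf, hLf⟩ := hL χ
    have hL1 : Lf 1 ≠ 0 := hn₁ n (le_of_max_le_right hn) χ hχU hprim Lf hLf
    obtain ⟨u, hudef⟩ : ∃ u : ℂ, u = ((((χ Φ.γK)⁻¹ : ℂˣ)) : ℂ) := ⟨_, rfl⟩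
    have hu : u ^ 7 ^ (n + 1) = 1 := by rw [hudef]; exact Φ.inv_chi_γK_pow_eq_one χ hχU
    have hprimu : IsPrimitiveRoot u (7 ^ (n + 1)) := by
      rw [hudef, Units.val_inv_eq_inv_val]; exact hprim.inv
    have hT : ∀ m : Φ.IK.H, D.val χ ((1 + PowerSeries.X : IwasawaAlgebra 7) • m) = u * D.val χ m := by
      intro m; rw [hudef]; exact D.val_T χ ⟨n + 1, hχU⟩ m
    have hC : ∀ (c : ℤ_[7]) (m : Φ.IK.H), D.val χ ((PowerSeries.C c : IwasawaAlgebra 7) • m) =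
        (D.ι₇.comp (algebraMap ℤ_[7] ℚ_[7])) c * D.val χ m := fun c m => D.val_C χ ⟨n + 1, hχU⟩ c m
    have hval : ∀ (f : IwasawaAlgebra 7) (m : Φ.IK.H),
        D.val χ (f • m) = charEval 7 (D.ι₇.comp (algebraMap ℤ_[7] ℚ_[7])) u (n + 1) f * D.val χ m :=
      fun f m => val_smul_eq_charEval_mul hT hC hu f m
    have hVZ : D.val χ D.zStar ≠ 0 :=
      Φ.ne_zero_of_valueLaw D.α_ne_zero (D.val_zStar n (le_of_max_le_left hn) χ hχU hprim Lf hLf) hL1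
    -- (art) LEVEL-WISE: a natural lift `a ≡ κ(𝔟) (mod 7^{n+1})`, `χ(𝔟)⁻¹ = u^a`, `σ_𝔟` acts by `u^a` at this level
    obtain ⟨a, ha⟩ := D.exists_nat_toZModPow_artExp 𝔟 (n + 1)
    have hw : (heckeIdealValue χ 𝔟)⁻¹ = u ^ a := by
      rw [hudef]; exact D.inv_heckeIdealValue_eq_pow χ hχU h𝔟 ha
    have hE : D.val χ (Φ.euK 𝔟) =
        ((N : ℂ) - CM.heckeCharIdealValue Φ.ψ 𝔟 * u ^ a) * (Φ.Ω⁻¹ * Lf 1) := by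
      rw [D.val_euK 𝔟 h𝔟 (n + 1) χ hχU Lf hLf, hw, hNdef, mul_assoc]
    have hZ : (c₁ : ℂ) * D.val χ D.zStar = ((D.α₀ : ℂ) + (D.α₁ : ℂ) * q) * (Φ.Ω⁻¹ * Lf 1) := by
      rw [hc₁, hqdef]; push_cast
      rw [D.val_zStar n (le_of_max_le_left hn) χ hχU hprim Lf hLf, mul_assoc]
    have hbq : 2 * CM.heckeCharIdealValue Φ.ψ 𝔟 = (b₀ : ℂ) + (b₁ : ℂ) * q := by rw [hqdef]; exact hb
    have hvpi : ∀ y : Φ.IK.H, D.val χ (Φ.piK y) = q * D.val χ y := by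
      intro y; rw [hqdef]; exact D.val_piK χ ⟨n + 1, hχU⟩ y
    have hM : Φ.Ω⁻¹ * Lf 1 ≠ 0 := mul_ne_zero (inv_ne_zero Φ.Ω_ne_zero) hL1
    have hPval : ∀ m : Φ.IK.H, D.val χ (P • m) = u ^ a * D.val χ m := by
      intro m; rw [hPdef, hudef]; exact D.val_sigma_smul_eq_pow χ hχU 𝔟 ha m
    have hev0 := ev_normForm_eq_zero Φ.piK (D.val χ) (charEval 7 (D.ι₇.comp (algebraMap ℤ_[7] ℚ_[7])) u (n + 1))
      hval Φ.piK_smul hq hvpi (D.val_intCast_smul χ ⟨n + 1, hχU⟩) hPval hdep hE hZ hbq hM hVZ hg₀ hg₁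
    exact coe_cyclotomic_comp_dvd_of_charEval_eq_zero 7 n D.ι₇ hprimu hev0
  -- STEP 1′ (separation + norm trick): `g₀ = g₁ = 0`
  have hzero : g₀ * g₀ + ((7 : ℤ) : IwasawaAlgebra 7) * (g₁ * g₁) = 0 := by
    refine eq_zero_of_infinite_setOf_cyclotomic_dvd 7 (Set.infinite_of_not_bddAbove ?_)
    rw [not_bddAbove_iff]
    intro m
    exact ⟨max (max D.n₀ n₁) (m + 1), hdiv _ (le_max_left _ _), lt_of_lt_of_le (Nat.lt_succ_self m) (le_max_right _ _)⟩
  have hg : g₀ = 0 ∧ g₁ = 0 := by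
    refine eq_zero_of_sq_add_C_mul_sq_eq_zero 7 ?_
    rw [map_natCast, sq, sq]
    push_cast at hzero
    exact hzero
  obtain ⟨hg₀0, hg₁0⟩ := hg
  have G0 : (c₁ : IwasawaAlgebra 7) * s * (((2 * N : ℕ) : ℤ) - (b₀ : IwasawaAlgebra 7) * P) =
      2 * ((D.α₀ : IwasawaAlgebra 7) * r₀ - ((7 * D.α₁ : ℤ) : IwasawaAlgebra 7) * r₁) := by
    rw [← sub_eq_zero, ← hg₀]; exact hg₀0
  have G1 : -((c₁ : IwasawaAlgebra 7) * (b₁ : IwasawaAlgebra 7) * s * P) =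
      2 * ((D.α₁ : IwasawaAlgebra 7) * r₀ + (D.α₀ : IwasawaAlgebra 7) * r₁) := by
    rw [← sub_eq_zero, ← hg₁]; exact hg₁0
  -- STEP 2 (module identity in `Φ.IK.H`)
  have h2 : (2 : IwasawaAlgebra 7) ≠ 0 := by
    have := intCast_iwasawaAlgebra_ne_zero (n := 2) (by norm_num); push_cast at this; exact this
  have hNΛ : ((D.α₀ ^ 2 + 7 * D.α₁ ^ 2 : ℤ) : IwasawaAlgebra 7) ≠ 0 := by
    rw [← D.natCast_normA_eq]; exact intCast_iwasawaAlgebra_ne_zero (by exact_mod_cast D.normA_ne_zero)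
  have hs : s ≠ 0 := by
    intro hs0
    rw [hs0] at G0 G1
    obtain ⟨hr₀, hr₁⟩ := r_eq_zero_of_s_eq_zero h2 hNΛ G0 G1
    rcases hne with h | h | h
    · exact h hs0
    · exact h hr₀
    · exact h hr₁
  have hpiK_sq : ∀ y : Φ.IK.H, Φ.piK (Φ.piK y) = ((-7 : ℤ) : IwasawaAlgebra 7) • y := fun y => by
    rw [Φ.piK_piK, Int.cast_smul_eq_zsmul]
  have hmod := module_identity Φ.piK Φ.piK_smul hpiK_sq htf hs hdep G0 G1
  -- STEP 3 (transport through `ιS` and the two-sided form)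
  have hιZ := iotaS_eq_of_unit_smul Φ.ιS Φ.π D.uStar
    (by rw [D.uStar_smul_zStar]; exact (Φ.j_apply hγ Φ.zOne).symm) Φ.k Φ.a Φ.u Φ.j_zOne
  have hEU : ((2 * (D.α₀ ^ 2 + 7 * D.α₁ ^ 2) : ℤ) : IwasawaAlgebra 7) • Φ.frame.EU 𝔟 =
      ((((algebraMap (IwasawaAlgebra 7) Φ.R (D.α₀ : IwasawaAlgebra 7) -
            algebraMap (IwasawaAlgebra 7) Φ.R (D.α₁ : IwasawaAlgebra 7) * Φ.π) *
          algebraMap (IwasawaAlgebra 7) Φ.R (c₁ : IwasawaAlgebra 7)) *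
        (algebraMap (IwasawaAlgebra 7) Φ.R ((((2 * N : ℕ) : ℤ) : IwasawaAlgebra 7) - (b₀ : IwasawaAlgebra 7) * P) -
          algebraMap (IwasawaAlgebra 7) Φ.R (b₁ : IwasawaAlgebra 7) * algebraMap (IwasawaAlgebra 7) Φ.R P * Φ.π)) *
        (algebraMap (IwasawaAlgebra 7) Φ.R (↑(D.uStar⁻¹) : IwasawaAlgebra 7) *
          (algebraMap (IwasawaAlgebra 7) Φ.R ((7 : IwasawaAlgebra 7) ^ Φ.k) * ((Φ.u : Φ.R) * Φ.π ^ Φ.a)))) • Φ.zS := by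
    rw [Φ.EU_eq 𝔟 h𝔟, ← map_smul, hmod, iotaS_transport Φ.ιS Φ.π Φ.piK Φ.ιS_piK Φ.piK_smul, hιZ, smul_smul]
  have h2s := twoSided_of_smul_eq Φ.π _ _ _ _ Φ.zeta_eq ht hEU
  subst hb₀def hb₁def hPdef hc₁ hNdef
  exact h2s

/-- ★′ **THE PERIOD-SCALED COMPARISON WITH EXPLICIT CONSTANTS, FROM ITS INPUTS**:
`π^{m₀ + 2jα} • EU_𝔟 = ((wα⁻¹·(D.cZ·t′))·D.xTilde 𝔟) • 𝐳_{γ′}` — `PeriodScaledComparisonShape Φ D.xTilde n c` with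
`n = m₀ + 2·v₇(α₀² + 7α₁²)` and `c = wα⁻¹·D.cZ·t′` NAMED (`wα⁻¹` through `isUnit_wα.unit`).  CONDITIONAL; nothing asserted; 19945 OPEN.
[cite: Kato2004Asterisque, (15.16.1) (p. 265), Thm. 12.4 (2) (p. 221)] -/
theorem periodScaledComparisonShape_of_katoExpDatum (hγ : K.IsTopGenerator γ) (Φ : PinnedKatoGenusFrame W K hK I d)
    (D : KatoExpDatum hγ Φ) (t' : Φ.R) (m₀ : ℕ) (ht : Φ.t * t' = Φ.π ^ m₀)
    (htf : ∀ (f : IwasawaAlgebra 7) (x : Φ.IK.H), f ≠ 0 → f • x = 0 → x = 0)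
    (hrk : ∀ x y : Φ.IK.H, ∃ s r₀ r₁ : IwasawaAlgebra 7,
      (s ≠ 0 ∨ r₀ ≠ 0 ∨ r₁ ≠ 0) ∧ s • x = r₀ • y + r₁ • Φ.piK y)
    (hχ : ∀ n : ℕ, ∃ χ : absoluteGaloisGroup Φ.Kcm →ₜ* ℂˣ,
      (∀ σ ∈ (K.restrictOfFinrankEqTwo (by decide) Φ.Kcm Φ.finrank_Kcm).layerSubgroup (n + 1), χ σ = 1) ∧
        IsPrimitiveRoot (((χ Φ.γK : ℂˣ)) : ℂ) (7 ^ (n + 1)))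
    (hL : ∀ χ : absoluteGaloisGroup Φ.Kcm →ₜ* ℂˣ, ∃ Lf : ℂ → ℂ, CM.IsDepletedHeckeL Φ.ψ χ (7 * (7 * F.d)) Lf)
    (hRoh : ∃ n₁ : ℕ, ∀ n : ℕ, n₁ ≤ n → ∀ χ : absoluteGaloisGroup Φ.Kcm →ₜ* ℂˣ,
      (∀ σ ∈ (K.restrictOfFinrankEqTwo (by decide) Φ.Kcm Φ.finrank_Kcm).layerSubgroup (n + 1), χ σ = 1) →
      IsPrimitiveRoot (((χ Φ.γK : ℂˣ)) : ℂ) (7 ^ (n + 1)) →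
      ∀ Lf : ℂ → ℂ, CM.IsDepletedHeckeL Φ.ψ χ (7 * (7 * F.d)) Lf → Lf 1 ≠ 0) :
    PeriodScaledComparisonShape Φ D.xTilde (m₀ + 2 * D.jα) ((↑(D.isUnit_wα.unit⁻¹) : Φ.R) * (D.cZ * t')) :=
  (twoSidedComparisonShape_of_katoExpDatum hγ Φ D t' m₀ ht htf hrk hχ hL hRoh).periodScaled D.isUnit_wα.unit (m₀ + 2 * D.jα)
    (by rw [IsUnit.unit_spec]; exact D.sTwoSided_eq m₀)

set_option maxHeartbeats 400000 in
/-- **`RationalComparisonShape Φ` FROM ITS INPUTS** (the (P3) currency; constants forgotten): (R3) `KatoExpCompatShape`,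
(ht′), (tf), (rk), characters, continuations, (r5′) ⇒ `∀ 𝔟 admissible, ∃ m C, π^m • EU_𝔟 = C • 𝐳_{γ′}`.
CONDITIONAL; nothing asserted; 19945 OPEN. [cite: Kato2004Asterisque, (15.16.1) (p. 265), Thm. 12.4 (2) (p. 221)] -/
theorem rationalComparisonShape_of_katoExpCompat (hγ : K.IsTopGenerator γ) (Φ : PinnedKatoGenusFrame W K hK I d)
    (hD : KatoExpCompatShape hγ Φ)
    (ht : ∃ (t' : Φ.R) (m₀ : ℕ), Φ.t * t' = Φ.π ^ m₀)
    (htf : ∀ (f : IwasawaAlgebra 7) (x : Φ.IK.H), f ≠ 0 → f • x = 0 → x = 0)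
    (hrk : ∀ x y : Φ.IK.H, ∃ s r₀ r₁ : IwasawaAlgebra 7,
      (s ≠ 0 ∨ r₀ ≠ 0 ∨ r₁ ≠ 0) ∧ s • x = r₀ • y + r₁ • Φ.piK y)
    (hχ : ∀ n : ℕ, ∃ χ : absoluteGaloisGroup Φ.Kcm →ₜ* ℂˣ,
      (∀ σ ∈ (K.restrictOfFinrankEqTwo (by decide) Φ.Kcm Φ.finrank_Kcm).layerSubgroup (n + 1), χ σ = 1) ∧
        IsPrimitiveRoot (((χ Φ.γK : ℂˣ)) : ℂ) (7 ^ (n + 1)))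
    (hL : ∀ χ : absoluteGaloisGroup Φ.Kcm →ₜ* ℂˣ, ∃ Lf : ℂ → ℂ, CM.IsDepletedHeckeL Φ.ψ χ (7 * (7 * F.d)) Lf)
    (hRoh : ∃ n₁ : ℕ, ∀ n : ℕ, n₁ ≤ n → ∀ χ : absoluteGaloisGroup Φ.Kcm →ₜ* ℂˣ,
      (∀ σ ∈ (K.restrictOfFinrankEqTwo (by decide) Φ.Kcm Φ.finrank_Kcm).layerSubgroup (n + 1), χ σ = 1) →
      IsPrimitiveRoot (((χ Φ.γK : ℂˣ)) : ℂ) (7 ^ (n + 1)) →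
      ∀ Lf : ℂ → ℂ, CM.IsDepletedHeckeL Φ.ψ χ (7 * (7 * F.d)) Lf → Lf 1 ≠ 0) :
    RationalComparisonShape Φ := by
  obtain ⟨D⟩ := hD
  obtain ⟨t', m₀, htt⟩ := ht
  exact (periodScaledComparisonShape_of_katoExpDatum hγ Φ D t' m₀ htt htf hrk hχ hL hRoh).rational

end Frame

/-! ## §2 The corollary for the pen: «K2cPinned» from (R3) `KatoExpCompatShape` + the binders + the divisibility kernel -/

/-- **«K2cPinned» FROM THE RE-TYPED DUAL-EXPONENTIAL DATUM, THE STRUCTURAL BINDERS AND THE DIVISIBILITY KERNEL** — the existential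
«∃ Φ, (R3) ∧ (ht′) ∧ (tf) ∧ (rk) ∧ hχ ∧ hL ∧ (r5′) ∧ `ComparisonDivisibilityShape Φ`» under the registered prefix
`★ → GZK → ∀ W ∈ 𝒞₇ ∀ (K, hK, γ, hγ, I), ∃ (F, θu) value-pinned, ∀ d`, yields the «K2cPinned» letter of (P1) (via
`rationalComparisonShape_of_katoExpCompat` and (P3) `k2cPinned_of_rational_of_divisibility`); consumed by the zp v17 touch
(T-art) of the registered stub.  CONDITIONAL; nothing asserted; 19945 OPEN.
[cite: Kato2004Asterisque, (15.16.1) (p. 265), Thm. 12.4 (2) (p. 221), Prop. 15.9 (p. 258)] -/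
theorem k2cPinned_of_katoExpCompat_of_divisibility
    (hRD : exists_zetaClassPosition_of_rank_le_one → rank_eq_analyticRank_of_analyticRank_le_one →
      ∀ (W : WeierstrassCurve ℚ) [W.IsElliptic] [W.IsGloballyMinimal] [Fact (Nat.Prime 7)], X12.ClassCSeven W →
      letI : ContinuousSMul ℤ_[7] (W.tateModule 7) := TateModule.continuousSMul_padicInt
      ∀ (K : ZpExtension ℚ 7) (hK : K.IsCyclotomic) (γ : Field.absoluteGaloisGroup ℚ) (hγ : K.IsTopGenerator γ)
        (I : IwasawaH1Data W 7 K γ),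
        ∃ (F : GenusFrame) (θu : ∀ n : ℕ, globalUnitsOf (F.layer n)), IsNormedEllipticUnitFamily F θu ∧
          ∀ d : GenusDatum F θu, ∃ Φ : PinnedKatoGenusFrame W K hK I d,
            KatoExpCompatShape hγ Φ ∧
            (∃ (t' : Φ.R) (m₀ : ℕ), Φ.t * t' = Φ.π ^ m₀) ∧
            (∀ (f : IwasawaAlgebra 7) (x : Φ.IK.H), f ≠ 0 → f • x = 0 → x = 0) ∧
            (∀ x y : Φ.IK.H, ∃ s r₀ r₁ : IwasawaAlgebra 7,
              (s ≠ 0 ∨ r₀ ≠ 0 ∨ r₁ ≠ 0) ∧ s • x = r₀ • y + r₁ • Φ.piK y) ∧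
            (∀ n : ℕ, ∃ χ : absoluteGaloisGroup Φ.Kcm →ₜ* ℂˣ,
              (∀ σ ∈ (K.restrictOfFinrankEqTwo (by decide) Φ.Kcm Φ.finrank_Kcm).layerSubgroup (n + 1), χ σ = 1) ∧
                IsPrimitiveRoot (((χ Φ.γK : ℂˣ)) : ℂ) (7 ^ (n + 1))) ∧
            (∀ χ : absoluteGaloisGroup Φ.Kcm →ₜ* ℂˣ, ∃ Lf : ℂ → ℂ, CM.IsDepletedHeckeL Φ.ψ χ (7 * (7 * F.d)) Lf) ∧
            (∃ n₁ : ℕ, ∀ n : ℕ, n₁ ≤ n → ∀ χ : absoluteGaloisGroup Φ.Kcm →ₜ* ℂˣ,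
              (∀ σ ∈ (K.restrictOfFinrankEqTwo (by decide) Φ.Kcm Φ.finrank_Kcm).layerSubgroup (n + 1), χ σ = 1) →
              IsPrimitiveRoot (((χ Φ.γK : ℂˣ)) : ℂ) (7 ^ (n + 1)) →
              ∀ Lf : ℂ → ℂ, CM.IsDepletedHeckeL Φ.ψ χ (7 * (7 * F.d)) Lf → Lf 1 ≠ 0) ∧
            ComparisonDivisibilityShape Φ) :
    exists_zetaClassPosition_of_rank_le_one → rank_eq_analyticRank_of_analyticRank_le_one →
      ∀ (W : WeierstrassCurve ℚ) [W.IsElliptic] [W.IsGloballyMinimal] [Fact (Nat.Prime 7)], X12.ClassCSeven W →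
      letI : ContinuousSMul ℤ_[7] (W.tateModule 7) := TateModule.continuousSMul_padicInt
      ∀ (K : ZpExtension ℚ 7) (hK : K.IsCyclotomic) (γ : Field.absoluteGaloisGroup ℚ) (_ : K.IsTopGenerator γ)
        (I : IwasawaH1Data W 7 K γ),
        ∃ (F : GenusFrame) (θu : ∀ n : ℕ, globalUnitsOf (F.layer n)), IsNormedEllipticUnitFamily F θu ∧
          ∀ d : GenusDatum F θu, ∃ Φ : PinnedKatoGenusFrame W K hK I d,
            ResidueIsGenusUnitClassShape Φ.toKatoGenusFrame := by
  refine k2cPinned_of_rational_of_divisibility fun hstar hGZK W _ _ _ hC K hK γ hγ I => ?_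
  haveI : ContinuousSMul ℤ_[7] (W.tateModule 7) := TateModule.continuousSMul_padicInt
  obtain ⟨F, θu, hpin, hΦ⟩ := hRD hstar hGZK W hC K hK γ hγ I
  refine ⟨F, θu, hpin, fun d => ?_⟩
  obtain ⟨Φ, hD, ht, htf, hrk, hχ, hL, hRoh, hDiv⟩ := hΦ d
  exact ⟨Φ, rationalComparisonShape_of_katoExpCompat hγ Φ hD ht htf hrk hχ hL hRoh, hDiv⟩

end Summit.BirchSwinnertonDyer.Rank1Residual.Additive.GenusSeven

end
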